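/-
Copyright: b2b-lace packet (CARVER gen 43, census v7, node KU-SEP, leaf KU-SEP-RED-KM2).
The `M̂²`-weighted instance of the d-generic BOUNDED-MAJORANT reduction of `SrwTrigMajorant`:
`KM₂_{n,l}(x)` (the one-factor Cauchy–Schwarz partner of `K_{n,l}(x)` for `T_{n,l}(x)`, tree
`srwKM2`) is bounded by the same combination of twisted moments and the second moment of `D̂^{(x)}`
under the weight `w = |D̂|^l M̂²`.  Elementary; hypothesis-free; no `sorry`; no statement at any specific
dimension; no number.
-/
import Literature.Probability.FitznerVanDerHofstad2017.SrwTrigMajorant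
import Literature.Probability.FitznerVanDerHofstad2017.SrwIntegralTOneFactorCS
import HarnessLib

/-!
# The KU-SEP reduction for the `M̂²`-insertion `KM₂_{n,l}(x)` (leaf KU-SEP-RED-KM2)

CITATION HEADER (PLACEMENT v2). Part of the certified REPRODUCTION of the numerical inputs of
R. Fitzner, R. van der Hofstad, *Generalized approach to the non-backtracking lace expansion*,
Probab. Theory Related Fields 169 (2017) 1041–1119 [NoBLE17-I] (arXiv:1506.07969), §3.3.3 and §5.2
((3.34)–(3.38) p. 1071; (5.9), (5.14) p. 1092), as consumed by *Mean-field behavior for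
nearest-neighbor percolation in `d > 10`*, Electron. J. Probab. 22 (2017) no. 43 [FvdH17].
Origin: build `lace`, unit `b2b-lace-carver-g43` (census v7, node KU-SEP: what-if / input-certification
support lane).  Nothing here is a statement about percolation and nothing is evaluated at a specific `d`.

## What is proved, and why

`SrwTrigMajorant` records the lever: for a measurable weight `0 ≤ w ≤ W`, `d ≥ 2n + 1` and any bounded
trigonometric majorant `|t| ≤ B + c t² + Σ_r a_r cos(b_r t)` on `[-1,1]`,
`∫ w |D̂^{(x)}| Ĉⁿ ≤ B·Tw^w_n(x;0) + c·Sq^w_n(x) + Σ_r a_r·Tw^w_n(x;b_r)`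
(`integral_weight_abs_DhatSym_le_of_trigMajorant`), instantiated there for `K_{n,l}` (`w = |D̂|^l`) and
`U_{n,l}` (`w = |D̂|^l D̂^{sin}`).  The one-factor Cauchy–Schwarz bound of `T_{n,l₁+l₂}(x)`
(`srwT_le_sqrt_srwK_mul_srwKM2`, module `SrwIntegralTOneFactorCS`) consumes, besides `K`, the
`M̂²`-insertion `KM₂_{n,l}(x) = ∫ |D̂|^l |D̂^{(x)}| M̂² Ĉⁿ` (`srwKM2`; `l = 0` and `l = 2` are the rows
`KM₂_n`, `KD²M₂_n` of the what-if tables).  This module is the corresponding instance of the lever with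
the weight `w = |D̂|^l M̂²`, which is measurable, nonnegative and bounded by `25` (`|D̂| ≤ 1`,
`|M̂| ≤ 5` for `d ≥ 1`: `abs_Dhat_pow_le_one`, `abs_Mhat_le_five`).  No number is produced: the twisted
moments and the second moment under this weight are inputs to be certified elsewhere, for whatever `d`.
-/

noncomputable section

open MeasureTheory Real Finset
open scoped BigOperators

namespace Literature.Probability.FitznerVanDerHofstad2017

open Literature.Barriers.CriticalPhenomena
open Literature.Barriers.CriticalPhenomena.Slade2006Prop53 (P)

variable {d : ℕ}

/-- The `KM₂` weight `w = |D̂|^l M̂²` is measurable.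
[cite: FitznerVanDerHofstad2016NoBLE, (3.36)–(3.37) p. 1071] -/
theorem measurable_abs_Dhat_pow_mul_Mhat_sq (l : ℕ) :
    Measurable fun k : Fin d → ℝ => |Dhat d k| ^ l * Mhat d k ^ 2 :=
  ((continuous_Dhat d).measurable.abs.pow_const l).mul ((measurable_Mhat d).pow_const 2)

/-- The `KM₂` weight is bounded: `|D̂(k)|^l M̂(k)² ≤ 25` for `d ≥ 1` (`|D̂| ≤ 1`, `|M̂| ≤ 5`).
[cite: HeydenreichVanDerHofstad2017, Prop. 5.5; FitznerVanDerHofstad2016NoBLE, (3.37) p. 1071] -/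
theorem abs_Dhat_pow_mul_Mhat_sq_le (hd : 1 ≤ d) (l : ℕ) (k : Fin d → ℝ) :
    |Dhat d k| ^ l * Mhat d k ^ 2 ≤ 25 := by
  have hD : |Dhat d k| ^ l ≤ 1 := abs_Dhat_pow_le_one l k
  have hM : Mhat d k ^ 2 ≤ 5 ^ 2 := by
    rw [← sq_abs]
    exact pow_le_pow_left₀ (abs_nonneg _) (abs_Mhat_le_five hd k) 2
  have h0 : 0 ≤ Mhat d k ^ 2 := sq_nonneg _
  calc |Dhat d k| ^ l * Mhat d k ^ 2 ≤ 1 * 5 ^ 2 :=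
        mul_le_mul hD hM h0 zero_le_one
    _ = 25 := by norm_num

/-- **`KM₂_{n,l}(x)` by a bounded majorant** (the KU-SEP reduction for the `M̂²`-insertion): for
`d ≥ 2n + 1` and `|t| ≤ B + c t² + Σ_r a_r cos(b_r t)` on `[-1,1]`,
`KM₂_{n,l}(x) ≤ B·Tw^w_n(x;0) + c·Sq^w_n(x) + Σ_r a_r·Tw^w_n(x;b_r)` with the weight `w = |D̂|^l M̂²`
(the Cauchy–Schwarz bound is the case `g(t) = (λ + λ⁻¹ t²)/2`).
[cite: FitznerVanDerHofstad2016NoBLE, (3.36)–(3.37) p. 1071; (5.9), (5.14) p. 1092] -/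
theorem srwKM2_le_of_trigMajorant {n : ℕ} (hd : 2 * n + 1 ≤ d) (l : ℕ) (x : Fin d → ℤ) {R : ℕ}
    (B c : ℝ) (a b : Fin R → ℝ)
    (hmaj : ∀ t ∈ Set.Icc (-1 : ℝ) 1, |t| ≤ B + c * t ^ 2 + ∑ r, a r * Real.cos (b r * t)) :
    srwKM2 d n l x ≤ B * srwTwist d n (fun k => |Dhat d k| ^ l * Mhat d k ^ 2) x 0
      + c * srwSqMom d n (fun k => |Dhat d k| ^ l * Mhat d k ^ 2) x
      + ∑ r, a r * srwTwist d n (fun k => |Dhat d k| ^ l * Mhat d k ^ 2) x (b r) := by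
  have hd1 : 1 ≤ d := by omega
  have e : srwKM2 d n l x =
      (∫ k, ((|Dhat d k| ^ l * Mhat d k ^ 2) * |DhatSym d x k|) * Chat d 1 k ^ n ∂P d) / (2 * π) ^ d := by
    rw [srwKM2]
    congr 1
    refine integral_congr_ae (ae_of_all _ fun k => ?_)
    show (|Dhat d k| ^ l * |DhatSym d x k| * Mhat d k ^ 2) * Chat d 1 k ^ n =
      ((|Dhat d k| ^ l * Mhat d k ^ 2) * |DhatSym d x k|) * Chat d 1 k ^ n
    ring
  rw [e]
  exact integral_weight_abs_DhatSym_le_of_trigMajorant hd (measurable_abs_Dhat_pow_mul_Mhat_sq l)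
    (fun k => mul_nonneg (pow_nonneg (abs_nonneg _) l) (sq_nonneg _))
    (fun k => abs_Dhat_pow_mul_Mhat_sq_le hd1 l k) x B c a b hmaj

/-- The twisted-moment integrand under the `KM₂` weight, `|D̂|^l M̂² cos(β D̂^{(x)}) Ĉⁿ`, is integrable for
`d ≥ 2n + 1` (so the right-hand side of `srwKM2_le_of_trigMajorant` is a sum of genuine integrals).
[cite: HeydenreichVanDerHofstad2017, Prop. 5.5; FitznerVanDerHofstad2016NoBLE, (3.37) p. 1071] -/
theorem integrable_KM2weight_cos_mul_Chat_pow {n : ℕ} (hd : 2 * n + 1 ≤ d) (l : ℕ) (x : Fin d → ℤ)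
    (β : ℝ) :
    Integrable (fun k => ((|Dhat d k| ^ l * Mhat d k ^ 2) * Real.cos (β * DhatSym d x k))
      * Chat d 1 k ^ n) (P d) := by
  have hd1 : 1 ≤ d := by omega
  exact integrable_weight_cos_mul_Chat_pow hd (measurable_abs_Dhat_pow_mul_Mhat_sq l)
    (fun k => by
      rw [abs_of_nonneg (mul_nonneg (pow_nonneg (abs_nonneg _) l) (sq_nonneg _))]
      exact abs_Dhat_pow_mul_Mhat_sq_le hd1 l k) x β

/-- The second-moment integrand under the `KM₂` weight, `|D̂|^l M̂² (D̂^{(x)})² Ĉⁿ`, is integrable for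
`d ≥ 2n + 1`. [cite: HeydenreichVanDerHofstad2017, Prop. 5.5; FitznerVanDerHofstad2016NoBLE, (3.37) p. 1071] -/
theorem integrable_KM2weight_sq_mul_Chat_pow {n : ℕ} (hd : 2 * n + 1 ≤ d) (l : ℕ) (x : Fin d → ℤ) :
    Integrable (fun k => ((|Dhat d k| ^ l * Mhat d k ^ 2) * DhatSym d x k ^ 2) * Chat d 1 k ^ n) (P d) := by
  have hd1 : 1 ≤ d := by omega
  exact integrable_weight_sq_mul_Chat_pow hd (measurable_abs_Dhat_pow_mul_Mhat_sq l)
    (fun k => by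
      rw [abs_of_nonneg (mul_nonneg (pow_nonneg (abs_nonneg _) l) (sq_nonneg _))]
      exact abs_Dhat_pow_mul_Mhat_sq_le hd1 l k) x

end Literature.Probability.FitznerVanDerHofstad2017

end
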